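import Literature.Geometry.Lorentzian.CoordConstraintBridge
import Literature.Geometry.Lorentzian.CoordConstraintAdjoint
import HarnessLib

/-!
# Tangents of smooth families of data with stationary constraints lie in the kernel of `DΦ`

Topic `Literature/Geometry/Lorentzian`. Everything here is PROVED; no definition, no statement of
`Prop` type is introduced.

The named fact `ChruscielDelay_localConstraintDeformation` (`LocalConstraintDeformation.lean`;
Chruściel–Delay 2003/2004, Corvino–Schoen 2006) prescribes the tangents `(aⱼ, bⱼ)` of the sought
family of vacuum data through WITNESS FAMILIES: `aⱼ`, `bⱼ` are the fibrewise `s`-derivatives at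
`s = 0` of a jointly smooth one-parameter family of data `F(s e₀)` through `D`, equal to `D` off a
compact `K`, along which the Hamiltonian and momentum constraint functions are stationary at
`s = 0` at every point. Step (ii) of the assembly of the fact needs these tangents as smooth,
symmetric, compactly supported elements of the kernel of the linearised constraint map
`P = DΦ_{(h,k)}` ("so `(bⱼ, aⱼ) ∈ ker P_{(k,h)}`, smooth, supported in `K`: chain rule"). This file
proves exactly that, for data on `E3 = ℝ³` (the chart picture; a general `3`-manifold is read
through a chart first), with `DΦ` the tree's coordinate linearised constraint map
(`MetricCoord.linHamFn`, `MetricCoord.linMomFn` of `CoordConstraintAdjoint.lean`,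
`CoordMomentumConstraintAdjoint.lean` — the `ρ`- and `J`-rows of Chruściel–Delay's `P(Q, h)`,
Mém. SMF 94 (2003), §2):

* `InitialDataSet.contDiff_coordH_family`, `contDiff_coordK_family` — the coordinate readings
  `(c, y) ↦ h_c(y)`, `(c, y) ↦ k_c(y)` of a smooth family of data on `E3`
  (`IsSmoothDataFamily`) are jointly `C^∞` maps `ℝᵐ × E3 → (E3 →L E3 →L ℝ)` (the bundle of bilinear
  forms over `E3` is trivialised by the identity, `contMDiffAt_bilinE3_iff`);
* `InitialDataSet.isMetricFamilyOn_coordH_line` — along the axis `s ↦ s e₀` this is a smooth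
  one-parameter family of metric components on `E3` in the sense of the coordinate calculus
  (`MetricCoord.IsMetricFamilyOn`, time set `univ`), so the first-variation formulas
  `IsMetricFamilyOn.hasDerivWithinAt_hamAt_linHamFn` / `hasDerivWithinAt_momFn_linMomFn` apply;
* `InitialDataSet.tDeriv_coordH_line_eq`, `tDeriv_coordK_line_eq` — the variations
  `∂_s h`, `∂_s k` at `s = 0` of that family ARE the fact's fibrewise `deriv`-tangents;
  `contDiff_tDeriv_coordH_line`, `…K…` (they are smooth), `tDeriv_coordH_line_symm`, `…K…`
  (symmetric), `tDeriv_coordH_line_eq_zero`, `…K…` (zero where the family is constant);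
* `InitialDataSet.linHamFn_lineTangent_eq_zero`, `linMomFn_lineTangent_eq_zero` — **if the
  Hamiltonian (resp. momentum) constraint function is stationary at `s = 0` at `y` along the
  family, then `DH_{(h,k)}(∂_s h, ∂_s k)(y) = 0` (resp. `DM_{(h,k)}(∂_s h, ∂_s k)(y) = 0`)**: the
  constraint functions of data on `E3` are `hamAt` / `momFn` of the coordinate readings
  (`hamiltonianConstraintFn_eq_hamAt_coord`, `momentumConstraintFn_eq_momFn_coord`, Bartnik–Isenberg
  2004, (2.1)–(2.2)), their `s`-derivatives are `DH`, `DM` of the variations (loc. cit.), and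
  derivatives are unique;
* `InitialDataSet.witnessTangent_mem_ker` — the package in the format of the fact's witness
  hypothesis: the witnessed pair `(a, b)` is smooth, symmetric, vanishes off `K`, and
  `DH_{(h,k)}(a, b) = 0`, `DM_{(h,k)}(a, b) = 0` on `E3`.

## References

* P. T. Chruściel, E. Delay, Mém. Soc. Math. Fr. 94 (2003), §2 (the operator `P` and its kernel).
  [ChruscielDelay2003]
* R. Bartnik, J. Isenberg, *The constraint equations* (2004), §2, (2.1)–(2.2) (the linearised
  constraint map). [BartnikIsenberg2004]
-/

noncomputable section

set_option maxSynthPendingDepth 3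

open Bundle Set Function Filter TopologicalSpace Manifold Module
open scoped Manifold ContDiff Topology

namespace Literature.Geometry.Lorentzian

namespace InitialDataSet

/-! ### The axis `s ↦ s e₀` of the parameter line `ℝ¹` -/

/-- `s e₀ = s • e₀` in `ℝ¹`, so the axis map is smooth. [folklore] -/
theorem contDiff_single_zero :
    ContDiff ℝ ∞ (fun s : ℝ ↦ (EuclideanSpace.single 0 s : EuclideanSpace ℝ (Fin 1))) := by
  have h : (fun s : ℝ ↦ (EuclideanSpace.single 0 s : EuclideanSpace ℝ (Fin 1))) =
      fun s : ℝ ↦ s • (EuclideanSpace.single 0 (1 : ℝ) : EuclideanSpace ℝ (Fin 1)) := by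
    funext s
    ext i
    simp
  rw [h]
  exact contDiff_id.smul contDiff_const

/-- `0 e₀ = 0`. [folklore] -/
theorem single_zero_zero : (EuclideanSpace.single 0 (0 : ℝ) : EuclideanSpace ℝ (Fin 1)) = 0 := by
  ext i
  simp

/-! ### Joint smoothness of the coordinate readings of a smooth family of data on `E3` -/

section Family

variable {m : ℕ} (F : EuclideanSpace ℝ (Fin m) → InitialDataSet (𝓡 3) E3)

/-- **The metric of a smooth family of data on `E3`, read in coordinates, is jointly smooth**:
`(c, y) ↦ coordH (F c) y = h_c(y)` is a `C^∞` map `ℝᵐ × E3 → (E3 →L E3 →L ℝ)` (bundle smoothness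
over the model space is plain smoothness, `contMDiffAt_bilinE3_iff`, and the product of model
spaces is a model space). [folklore] -/
theorem contDiff_coordH_family (hF : IsSmoothDataFamily m F) :
    ContDiff ℝ ∞ (fun p : EuclideanSpace ℝ (Fin m) × E3 ↦ (F p.1).coordH p.2) := by
  have h2 : ContMDiff (𝓘(ℝ, EuclideanSpace ℝ (Fin m)).prod (𝓡 3)) 𝓘(ℝ, E3 →L[ℝ] E3 →L[ℝ] ℝ) ∞
      (fun p : EuclideanSpace ℝ (Fin m) × E3 ↦ (F p.1).coordH p.2) :=
    fun p ↦ (contMDiffAt_bilinE3_iff.1 (hF.1 p)).2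
  rw [← modelWithCornersSelf_prod, chartedSpaceSelf_prod] at h2
  exact contMDiff_iff_contDiff.1 h2

/-- **The tensor `k` of a smooth family of data on `E3`, read in coordinates, is jointly
smooth.** [folklore] -/
theorem contDiff_coordK_family (hF : IsSmoothDataFamily m F) :
    ContDiff ℝ ∞ (fun p : EuclideanSpace ℝ (Fin m) × E3 ↦ (F p.1).coordK p.2) := by
  have h2 : ContMDiff (𝓘(ℝ, EuclideanSpace ℝ (Fin m)).prod (𝓡 3)) 𝓘(ℝ, E3 →L[ℝ] E3 →L[ℝ] ℝ) ∞
      (fun p : EuclideanSpace ℝ (Fin m) × E3 ↦ (F p.1).coordK p.2) :=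
    fun p ↦ (contMDiffAt_bilinE3_iff.1 (hF.2 p)).2
  rw [← modelWithCornersSelf_prod, chartedSpaceSelf_prod] at h2
  exact contMDiff_iff_contDiff.1 h2

end Family

/-! ### The line family along the axis and its variations -/

section Line

variable (F : EuclideanSpace ℝ (Fin 1) → InitialDataSet (𝓡 3) E3)

/-- **Along the axis, a smooth family of data on `E3` is a smooth one-parameter family of metric
components** in the sense of the coordinate calculus (`MetricCoord.IsMetricFamilyOn`, time set
`univ`, domain `univ`): each `h_{s e₀}` is a smooth symmetric nondegenerate field
(`isMetricOn_coordH`) and `(y, s) ↦ h_{s e₀}(y)` is `C^∞`. [folklore] -/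
theorem isMetricFamilyOn_coordH_line (hF : IsSmoothDataFamily 1 F) :
    MetricCoord.IsMetricFamilyOn (fun s y ↦ (F (EuclideanSpace.single 0 s)).coordH y) univ univ where
  isMetricOn s _ := (F (EuclideanSpace.single 0 s)).isMetricOn_coordH
  contDiffOn := ((contDiff_coordH_family F hF).comp
    ((contDiff_single_zero.comp contDiff_snd).prodMk contDiff_fst)).contDiffOn
  uniqueDiffOn := uniqueDiffOn_univ
  subset_closure_interior := by simp

/-- Along the axis, `(y, s) ↦ k_{s e₀}(y)` is `C^∞`. [folklore] -/
theorem contDiffOn_coordK_line (hF : IsSmoothDataFamily 1 F) :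
    ContDiffOn ℝ ∞ (fun p : E3 × ℝ ↦ (F (EuclideanSpace.single 0 p.2)).coordK p.1) (univ ×ˢ univ) :=
  ((contDiff_coordK_family F hF).comp
    ((contDiff_single_zero.comp contDiff_snd).prodMk contDiff_fst)).contDiffOn

/-- **The variation `∂_s h` at `s = 0` of the line family is the fact's fibrewise tangent**
`y ↦ d/ds|₀ h_{s e₀}(y)` (`MetricCoord.tDeriv` within `univ` is the plain derivative).
[folklore] -/
theorem tDeriv_coordH_line_eq :
    MetricCoord.tDeriv (fun s y ↦ (F (EuclideanSpace.single 0 s)).coordH y) univ 0 =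
      fun y ↦ deriv (fun s : ℝ ↦ (show E3 →L[ℝ] E3 →L[ℝ] ℝ from
        (F (EuclideanSpace.single 0 s)).h.inner y)) 0 := by
  funext y
  rw [MetricCoord.tDeriv, derivWithin_univ]
  rfl

/-- **The variation `∂_s k` at `s = 0` of the line family is the fact's fibrewise tangent**
`y ↦ d/ds|₀ k_{s e₀}(y)`. [folklore] -/
theorem tDeriv_coordK_line_eq :
    MetricCoord.tDeriv (fun s y ↦ (F (EuclideanSpace.single 0 s)).coordK y) univ 0 =
      fun y ↦ deriv (fun s : ℝ ↦ (show E3 →L[ℝ] E3 →L[ℝ] ℝ from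
        (F (EuclideanSpace.single 0 s)).k y)) 0 := by
  funext y
  rw [MetricCoord.tDeriv, derivWithin_univ]
  rfl

/-- The variation `∂_s h` at `s = 0` is a `C^∞` field on `E3`. [folklore] -/
theorem contDiff_tDeriv_coordH_line (hF : IsSmoothDataFamily 1 F) :
    ContDiff ℝ ∞ (MetricCoord.tDeriv (fun s y ↦ (F (EuclideanSpace.single 0 s)).coordH y) univ 0) :=
  contDiffOn_univ.1 ((isMetricFamilyOn_coordH_line F hF).contDiffOn_tDeriv (mem_univ _))

/-- The variation `∂_s k` at `s = 0` is a `C^∞` field on `E3`. [folklore] -/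
theorem contDiff_tDeriv_coordK_line (hF : IsSmoothDataFamily 1 F) :
    ContDiff ℝ ∞ (MetricCoord.tDeriv (fun s y ↦ (F (EuclideanSpace.single 0 s)).coordK y) univ 0) :=
  contDiffOn_univ.1 (MetricCoord.contDiffOn_derivWithin_tslice isOpen_univ uniqueDiffOn_univ
    (contDiffOn_coordK_line F hF) (mem_univ _))

/-- The variation of a family of SYMMETRIC forms, differentiable in the parameter, is symmetric
(uniqueness of derivatives). [folklore] -/
theorem derivWithin_symm_of_symm {B : ℝ → E3 →L[ℝ] E3 →L[ℝ] ℝ} {t : ℝ}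
    (hB : ∀ s v w, B s v w = B s w v) (v w : E3) :
    derivWithin B univ t v w = derivWithin B univ t w v := by
  rw [derivWithin_univ]
  by_cases hd : DifferentiableAt ℝ B t
  · have h1 : HasDerivAt (fun s ↦ B s v w) (deriv B t v w) t := by
      have a := (hd.hasDerivAt.clm_apply (hasDerivAt_const t v))
      simp only [map_zero, add_zero] at a
      have a2 := a.clm_apply (hasDerivAt_const t w)
      simpa using a2
    have h2 : HasDerivAt (fun s ↦ B s w v) (deriv B t w v) t := by
      have a := (hd.hasDerivAt.clm_apply (hasDerivAt_const t w))
      simp only [map_zero, add_zero] at a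
      have a2 := a.clm_apply (hasDerivAt_const t v)
      simpa using a2
    have heq : (fun s ↦ B s v w) = fun s ↦ B s w v := funext fun s ↦ hB s v w
    rw [heq] at h1
    exact h1.unique h2
  · rw [deriv_zero_of_not_differentiableAt hd]
    rfl

/-- The variation `∂_s h` at `s = 0` is a field of SYMMETRIC forms. [folklore] -/
theorem tDeriv_coordH_line_symm (y v w : E3) :
    MetricCoord.tDeriv (fun s y ↦ (F (EuclideanSpace.single 0 s)).coordH y) univ 0 y v w =
      MetricCoord.tDeriv (fun s y ↦ (F (EuclideanSpace.single 0 s)).coordH y) univ 0 y w v :=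
  derivWithin_symm_of_symm (B := fun s ↦ (F (EuclideanSpace.single 0 s)).coordH y)
    (fun s v w ↦ (F (EuclideanSpace.single 0 s)).h.symm y v w) v w

/-- The variation `∂_s k` at `s = 0` is a field of SYMMETRIC forms. [folklore] -/
theorem tDeriv_coordK_line_symm (y v w : E3) :
    MetricCoord.tDeriv (fun s y ↦ (F (EuclideanSpace.single 0 s)).coordK y) univ 0 y v w =
      MetricCoord.tDeriv (fun s y ↦ (F (EuclideanSpace.single 0 s)).coordK y) univ 0 y w v :=
  derivWithin_symm_of_symm (B := fun s ↦ (F (EuclideanSpace.single 0 s)).coordK y)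
    (fun s v w ↦ (F (EuclideanSpace.single 0 s)).k_symm y v w) v w

/-- Where the metrics of the family do not depend on the parameter, `∂_s h = 0`. [folklore] -/
theorem tDeriv_coordH_line_eq_zero {y : E3}
    (h : ∀ c : EuclideanSpace ℝ (Fin 1), (F c).h.inner y = (F 0).h.inner y) :
    MetricCoord.tDeriv (fun s y ↦ (F (EuclideanSpace.single 0 s)).coordH y) univ 0 y = 0 := by
  rw [MetricCoord.tDeriv, derivWithin_univ]
  have heq : (fun s : ℝ ↦ (F (EuclideanSpace.single 0 s)).coordH y) = fun _ ↦ (F 0).coordH y :=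
    funext fun s ↦ h _
  rw [heq, deriv_const]

/-- Where the tensors `k` of the family do not depend on the parameter, `∂_s k = 0`.
[folklore] -/
theorem tDeriv_coordK_line_eq_zero {y : E3}
    (h : ∀ c : EuclideanSpace ℝ (Fin 1), (F c).k y = (F 0).k y) :
    MetricCoord.tDeriv (fun s y ↦ (F (EuclideanSpace.single 0 s)).coordK y) univ 0 y = 0 := by
  rw [MetricCoord.tDeriv, derivWithin_univ]
  have heq : (fun s : ℝ ↦ (F (EuclideanSpace.single 0 s)).coordK y) = fun _ ↦ (F 0).coordK y :=
    funext fun s ↦ h _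
  rw [heq, deriv_const]

/-! ### Stationary constraints ⇒ the variation is in the kernel of `DΦ` -/

/-- **Stationary Hamiltonian constraint ⇒ `DH(∂_s h, ∂_s k) = 0`.** If along the line family the
Hamiltonian constraint function at `y` is stationary at `s = 0`, then the linearised Hamiltonian
constraint of the variation vanishes at `y`:
`DH_{(h₀,k₀)}(∂_s h, ∂_s k)(y) = 0` (the constraint function is `hamAt` of the coordinate readings,
whose `s`-derivative is `DH` of the variations; derivatives are unique).
[cite: BartnikIsenberg2004, (2.1)] -/
theorem linHamFn_lineTangent_eq_zero (hF : IsSmoothDataFamily 1 F) {ι : Type*} [Fintype ι]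
    (b : Basis ι ℝ E3) (y : E3)
    (hH : HasDerivAt (fun s : ℝ ↦
      haveI := (F (EuclideanSpace.single 0 s)).metric.hasLeviCivita
      (F (EuclideanSpace.single 0 s)).hamiltonianConstraintFn y) 0 0) :
    MetricCoord.linHamFn b (F 0).coordH (F 0).coordK
      (MetricCoord.tDeriv (fun s y ↦ (F (EuclideanSpace.single 0 s)).coordH y) univ 0)
      (MetricCoord.tDeriv (fun s y ↦ (F (EuclideanSpace.single 0 s)).coordK y) univ 0) y = 0 := by
  have hfam := isMetricFamilyOn_coordH_line F hF
  have hK := contDiffOn_coordK_line F hF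
  have hKs : ∀ s ∈ (univ : Set ℝ), ∀ v w, (F (EuclideanSpace.single 0 s)).coordK y v w =
      (F (EuclideanSpace.single 0 s)).coordK y w v :=
    fun s _ v w ↦ (F (EuclideanSpace.single 0 s)).k_symm y v w
  have hd := hfam.hasDerivWithinAt_hamAt_linHamFn b hK (mem_univ y) (mem_univ (0 : ℝ)) hKs
  have heq : (fun s : ℝ ↦ MetricCoord.hamAt (F (EuclideanSpace.single 0 s)).coordH
      (F (EuclideanSpace.single 0 s)).coordK y) =
      fun s : ℝ ↦
        haveI := (F (EuclideanSpace.single 0 s)).metric.hasLeviCivita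
        (F (EuclideanSpace.single 0 s)).hamiltonianConstraintFn y := by
    funext s
    haveI := (F (EuclideanSpace.single 0 s)).metric.hasLeviCivita
    exact ((F (EuclideanSpace.single 0 s)).hamiltonianConstraintFn_eq_hamAt_coord y).symm
  have hd' := hasDerivWithinAt_univ.1 hd
  rw [heq] at hd'
  have hu := hd'.unique hH
  rw [show (F 0) = F (EuclideanSpace.single 0 (0 : ℝ)) by rw [single_zero_zero]]
  exact hu

/-- **Stationary momentum constraint ⇒ `DM(∂_s h, ∂_s k) = 0`.** If along the line family the
momentum constraint covector at `y` is stationary at `s = 0` (in every direction `v`), then the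
linearised momentum constraint of the variation vanishes at `y`:
`DM_{(h₀,k₀)}(∂_s h, ∂_s k)(y)(Z) = 0` for every `Z`. [cite: BartnikIsenberg2004, (2.2)] -/
theorem linMomFn_lineTangent_eq_zero (hF : IsSmoothDataFamily 1 F) {ι : Type*} [Fintype ι]
    (b : Basis ι ℝ E3) (y : E3)
    (hM : ∀ v : E3, HasDerivAt (fun s : ℝ ↦
      haveI := (F (EuclideanSpace.single 0 s)).metric.hasLeviCivita
      (F (EuclideanSpace.single 0 s)).momentumConstraintFn y v) 0 0) (Z : E3) :
    MetricCoord.linMomFn b (F 0).coordH (F 0).coordK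
      (MetricCoord.tDeriv (fun s y ↦ (F (EuclideanSpace.single 0 s)).coordH y) univ 0)
      (MetricCoord.tDeriv (fun s y ↦ (F (EuclideanSpace.single 0 s)).coordK y) univ 0) y Z = 0 := by
  have hfam := isMetricFamilyOn_coordH_line F hF
  have hK := contDiffOn_coordK_line F hF
  have hd := hfam.hasDerivWithinAt_momFn_linMomFn b
    (K := fun s y ↦ (F (EuclideanSpace.single 0 s)).coordK y) hK (mem_univ y) (mem_univ (0 : ℝ)) Z
  have heq : (fun s : ℝ ↦ MetricCoord.momFn b (F (EuclideanSpace.single 0 s)).coordH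
      (F (EuclideanSpace.single 0 s)).coordK y Z) =
      fun s : ℝ ↦
        haveI := (F (EuclideanSpace.single 0 s)).metric.hasLeviCivita
        (F (EuclideanSpace.single 0 s)).momentumConstraintFn y Z := by
    funext s
    haveI := (F (EuclideanSpace.single 0 s)).metric.hasLeviCivita
    exact ((F (EuclideanSpace.single 0 s)).momentumConstraintFn_eq_momFn_coord b y Z).symm
  have hd' := hasDerivWithinAt_univ.1 hd
  rw [heq] at hd'
  have hu := hd'.unique (hM Z)
  rw [show (F 0) = F (EuclideanSpace.single 0 (0 : ℝ)) by rw [single_zero_zero]]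
  exact hu

end Line

/-! ### The package in the format of the fact's witness hypothesis -/

/-- **The witnessed tangents of `ChruscielDelay_localConstraintDeformation` (data on `E3`) are
smooth, symmetric, compactly supported kernel elements of the linearised constraint map.** Let
`(a, b)` be witnessed as in the fact: there is a jointly smooth one-parameter family `F` of data
through `D = F 0`, equal to `D` off `K`, whose fibrewise `s`-derivatives at `0` along the axis are
`a` (metric) and `b` (second fundamental form), and along which both constraint functions are
stationary at `s = 0` at every point. Then `a` and `b` are `C^∞` fields of symmetric forms on
`E3`, vanish off `K`, and `DH_{(h,k)}(a, b) = 0`, `DM_{(h,k)}(a, b) = 0` on `E3` (in any basis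
`b₀`; `MetricCoord.linHamFn`, `MetricCoord.linMomFn`) — "`(bⱼ, aⱼ) ∈ ker P_{(k,h)}`, smooth,
supported in `K`" of step (ii) of the assembly of the fact. [cite: ChruscielDelay2003, §2] -/
theorem witnessTangent_mem_ker (D : InitialDataSet (𝓡 3) E3) (K : Set E3)
    (a b : Π x : E3, TangentSpace (𝓡 3) x →L[ℝ] TangentSpace (𝓡 3) x →L[ℝ] ℝ)
    (hw : ∃ F : EuclideanSpace ℝ (Fin 1) → InitialDataSet (𝓡 3) E3,
      InitialDataSet.IsSmoothDataFamily 1 F ∧ F 0 = D ∧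
      (∀ (c : EuclideanSpace ℝ (Fin 1)) (x : E3), x ∉ K →
        (F c).h.inner x = D.h.inner x ∧ (F c).k x = D.k x) ∧
      (fun x : E3 ↦ deriv (fun s : ℝ ↦ (show E3 →L[ℝ] E3 →L[ℝ] ℝ from
        (F (EuclideanSpace.single 0 s)).h.inner x)) 0) = a ∧
      (fun x : E3 ↦ deriv (fun s : ℝ ↦ (show E3 →L[ℝ] E3 →L[ℝ] ℝ from
        (F (EuclideanSpace.single 0 s)).k x)) 0) = b ∧
      ∀ x : E3,
        HasDerivAt (fun s : ℝ ↦
          haveI := (F (EuclideanSpace.single 0 s)).metric.hasLeviCivita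
          (F (EuclideanSpace.single 0 s)).hamiltonianConstraintFn x) 0 0 ∧
        ∀ v : TangentSpace (𝓡 3) x,
          HasDerivAt (fun s : ℝ ↦
            haveI := (F (EuclideanSpace.single 0 s)).metric.hasLeviCivita
            (F (EuclideanSpace.single 0 s)).momentumConstraintFn x v) 0 0)
    {ι : Type*} [Fintype ι] (b₀ : Basis ι ℝ E3) :
    ContDiff ℝ ∞ (fun x : E3 ↦ (show E3 →L[ℝ] E3 →L[ℝ] ℝ from a x)) ∧
    ContDiff ℝ ∞ (fun x : E3 ↦ (show E3 →L[ℝ] E3 →L[ℝ] ℝ from b x)) ∧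
    (∀ x : E3, ∀ v w : E3, a x v w = a x w v) ∧
    (∀ x : E3, ∀ v w : E3, b x v w = b x w v) ∧
    (∀ x : E3, x ∉ K → a x = 0 ∧ b x = 0) ∧
    ∀ y : E3,
      MetricCoord.linHamFn b₀ D.coordH D.coordK
        (fun x : E3 ↦ (show E3 →L[ℝ] E3 →L[ℝ] ℝ from a x))
        (fun x : E3 ↦ (show E3 →L[ℝ] E3 →L[ℝ] ℝ from b x)) y = 0 ∧
      ∀ Z : E3, MetricCoord.linMomFn b₀ D.coordH D.coordK
        (fun x : E3 ↦ (show E3 →L[ℝ] E3 →L[ℝ] ℝ from a x))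
        (fun x : E3 ↦ (show E3 →L[ℝ] E3 →L[ℝ] ℝ from b x)) y Z = 0 := by
  obtain ⟨F, hF, hF0, hoff, ha, hb, hstat⟩ := hw
  subst hF0
  have haT : a = MetricCoord.tDeriv (fun s y ↦ (F (EuclideanSpace.single 0 s)).coordH y) univ 0 :=
    ha.symm.trans (tDeriv_coordH_line_eq F).symm
  have hbT : b = MetricCoord.tDeriv (fun s y ↦ (F (EuclideanSpace.single 0 s)).coordK y) univ 0 :=
    hb.symm.trans (tDeriv_coordK_line_eq F).symm
  subst haT hbT
  refine ⟨contDiff_tDeriv_coordH_line F hF, contDiff_tDeriv_coordK_line F hF,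
    tDeriv_coordH_line_symm F, tDeriv_coordK_line_symm F, fun x hx ↦ ⟨?_, ?_⟩, fun y ↦ ⟨?_, ?_⟩⟩
  · exact tDeriv_coordH_line_eq_zero F fun c ↦ (hoff c x hx).1
  · exact tDeriv_coordK_line_eq_zero F fun c ↦ (hoff c x hx).2
  · exact linHamFn_lineTangent_eq_zero F hF b₀ y (hstat y).1
  · exact fun Z ↦ linMomFn_lineTangent_eq_zero F hF b₀ y (hstat y).2 Z

end InitialDataSet

end Literature.Geometry.Lorentzian

end
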